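import Summits.BirchSwinnertonDyer.BirchSwinnertonDyer.Theorems.SmallImageMuTransferMuTransferX9StepsTwoFourTransport
import HarnessLib

/-!
# Transport kit for `stub_stepsTwoFour*` (skeleton v5/v6 of crux 19276 `MuTransferX9`), part 2:
# everything at the DISTINGUISHED prime — the value of a cocycle at an arbitrary Frobenius `Fr` of
# `𝔓 ∣ v` through `t·Fr·t⁻¹` (a Frobenius at `𝔓₀`) and the distinguished inertia `I_{𝔓₀} = res(I_{K_v})`

Cell `b2b-bsdres` (X9 prover lineage, GEN 44) serving the K6 route `SmallImageMuTransfer` of cell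
`bsd-smallim`. HONEST FRAMING: the cell deletes COMBINATION-SHAPED residual classes of the rank-≤1
BSD formula from PUBLISHED theorems only and TYPES the construction-shaped remainder; this is not
"finishing BSD"; class X9 stays TYPED at class level. `--supports` helper toward the registered stub
`stub_stepsTwoFourOdd` (v6; = v5's `stub_stepsTwoFourX9` class-free) of stmt-BirchSwinnertonDyer-19276;
books nothing, closes nothing; theorems only (no definition, no named fact).

Sequel of `…X9StepsTwoFourTransport.lean` (p452883).  There, §1–§2 move a cocycle value from a
Frobenius `Fr` at `𝔓` to the distinguished local Frobenius through the inertia group AT `𝔓`; here the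
same is done touching ONLY the distinguished prime `𝔓₀ = adicCompletionPrime K v` and its inertia
`I_{𝔓₀} = res(I_{K_v})` (`inertia_adicCompletionPrime_eq_map_absInertia`), which is where the tree's
unramifiedness criteria live (x9 `X11b.LocBridge.mem_unramifiedSubgroup_one_iff_forall_eq_zero`, koly
`toLocal_twistModP_apply_of_mem_absInertia`): `t·Fr·t⁻¹` is a Frobenius at `𝔓₀` (`t • 𝔓 = 𝔓₀`), it
differs from `res r` by an element of `I_{𝔓₀}`, hence
`Φ(Fr) = t⁻¹·Φ(res r) − (Fr·Φ(t⁻¹) − Φ(t⁻¹))` for every cocycle `Φ` vanishing on `res(I_{K_v})` with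
values in a module fixed by `res(I_{K_v})` — ONE `t` for all cocycles (both `Φ` and `Ψc` of the stub), so
`(Φ(Fr), Ψc(Fr))` is the `t⁻¹`-translate of `(Φ(res r), Ψc(res r))` up to `(Fr − 1)`-ambiguities, which
`twistModP_apply_sub_self_mem_range_of_depth` puts in `S^{pⁿ}·𝒯_J` and
`forall_convCoeff_aeval_eq_zero_of_translate` absorbs (part 1, §3–§4).

PARTITION (D-0054): X9 (A4) · X10∧¬Surj (A5) at `p = 3` (prime-generic) — hypothesis-discharging helper
toward `stub_stepsTwoFourOdd`; closes NONE.

References: J.-P. Serre, *Local Fields*, I §8, VII §5 [SerreLocalFields1979]; J. Neukirch, *Algebraic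
Number Theory*, I §9 (9.1), II §9 (9.6) [NeukirchANT1999]; HOME/koly/MU-TRANSFER-PROOF.md §5 STEP 2.
-/

-- the summit and its single problem are both named `BirchSwinnertonDyer` (registry layout D-0017)
set_option linter.dupNamespace false

set_option autoImplicit false

noncomputable section

open scoped NumberField Pointwise
open Field WeierstrassCurve Literature.NumberTheory.EllipticCurves
  Literature.NumberTheory.GaloisRepresentations Function IsDedekindDomain NumberField
open Literature.NumberTheory.GaloisRepresentations.IsNonarchimedeanLocalField
open Literature.NumberTheory.Automorphic

namespace Summit.BirchSwinnertonDyer.BirchSwinnertonDyer.Rank1Residual.StepsTwoFourTransport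

/-! ### §1 Frobenius transport, distinguished-inertia form -/

section Distinguished

universe u

variable {K : Type u} [Field K] [NumberField K]

/-- **Frobenius transport, distinguished-inertia form.**  For a prime `𝔓 ∣ v` and an arithmetic
Frobenius `Fr` at `𝔓` there is `t ∈ Γ_K` (`t • 𝔓 = 𝔓₀`) such that `t·Fr·t⁻¹` is an arithmetic
Frobenius at the distinguished prime `𝔓₀ = adicCompletionPrime K v` and, for EVERY arithmetic Frobenius
`r` of `K_v`, `(res r)·(t·Fr·t⁻¹)⁻¹` lies in `I_{𝔓₀}`, the image of the local inertia group `I_{K_v}`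
under `res` (`inertia_adicCompletionPrime_eq_map_absInertia`).
[cite: NeukirchANT1999, Ch. I §9 Prop. (9.1) and Ch. II §9 Prop. (9.6)] [cite: SerreLocalFields1979, Ch. I §8] -/
theorem exists_forall_isAbsArithFrob_mul_inv_conj_mem_map_absInertia {v : HeightOneSpectrum (𝓞 K)}
    {𝔓 : Ideal (absIntegers (𝓞 K) K)} (h𝔓 : 𝔓 ∈ v.primesAbove) {Fr : absoluteGaloisGroup K}
    (hFr : IsArithFrobAt (𝓞 K) Fr 𝔓) :
    ∃ t : absoluteGaloisGroup K,
      IsArithFrobAt (𝓞 K) (t * Fr * t⁻¹) (adicCompletionPrime K v) ∧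
      ∀ r : absoluteGaloisGroup (v.adicCompletion K), IsAbsArithFrob r →
        absGaloisRestrict K (v.adicCompletion K) r * (t * Fr * t⁻¹)⁻¹ ∈
          (absInertia (v.adicCompletion K)).map
            (absGaloisRestrict K (v.adicCompletion K)).toMonoidHom := by
  classical
  haveI : 𝔓.IsPrime := h𝔓.1
  obtain ⟨t, ht⟩ := HeightOneSpectrum.exists_smul_eq_of_mem_primesAbove_holds h𝔓
    (adicCompletionPrime_mem_primesAbove K v)
  have hconj : IsArithFrobAt (𝓞 K) (t * Fr * t⁻¹) (adicCompletionPrime K v) := ht ▸ hFr.conj t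
  refine ⟨t, hconj, fun r hr => ?_⟩
  have hres : IsArithFrobAt (𝓞 K) (absGaloisRestrict K (v.adicCompletion K) r)
      (adicCompletionPrime K v) :=
    (isArithFrobAt_absGaloisRestrict_adicCompletionPrime_iff K v
      (by rw [residueFieldCard_adicCompletion_eq K v, HeightOneSpectrum.residueCard_eq_card_quotient])
      r).2 hr
  rw [← inertia_adicCompletionPrime_eq_map_absInertia]
  exact hres.mul_inv_mem_inertia hconj

end Distinguished

/-! ### §2 The value at `Fr` from the value at the distinguished local Frobenius -/

section DistinguishedCocycle

universe u v

variable {R : Type u} [Ring R] [TopologicalSpace R]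
variable {G : Type v} [Group G] [TopologicalSpace G]
variable {X : TopRep.{v} R G}

/-- **The value at `Fr` from the value at a local Frobenius**, abstract form: if
`ρr·(t·Fr·t⁻¹)⁻¹ ∈ I` with `I` acting trivially on `X` and `Φ|_I = 0` (in the application: `I` the
distinguished inertia `res(I_{K_v})`, `ρr = res r`), then
`Φ(Fr) = t⁻¹·Φ(ρr) − (Fr·Φ(t⁻¹) − Φ(t⁻¹))` — a translate plus the "`(Fr − 1)`-ambiguity", which for
an `E`-split `Fr` of depth `n` lies in `S^{pⁿ}·𝒯_J` (`twistModP_apply_sub_self_mem_range_of_depth`).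
[cite: SerreLocalFields1979, VII §5] -/
theorem apply_eq_smul_apply_sub_of_mul_inv_conj_mem (Φ : contOneCocycles X) {I : Subgroup G}
    (hIX : ∀ j ∈ I, ∀ x : X, X.ρ j x = x) (hI0 : ∀ j ∈ I, Φ.1 j = 0) {t Fr ρr : G}
    (h : ρr * (t * Fr * t⁻¹)⁻¹ ∈ I) :
    Φ.1 Fr = X.ρ t⁻¹ (Φ.1 ρr) - (X.ρ Fr (Φ.1 t⁻¹) - Φ.1 t⁻¹) := by
  have h1 : Φ.1 (t * Fr * t⁻¹) = Φ.1 ρr :=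
    apply_eq_of_mul_inv_mem_of_forall_apply_eq_zero Φ hIX hI0 h
  have h2 : Fr = t⁻¹ * (t * Fr * t⁻¹) * t⁻¹⁻¹ := by group
  have h3 := apply_conj_eq_smul_sub Φ t⁻¹ (t * Fr * t⁻¹)
  rw [← h2, h1] at h3
  exact h3

end DistinguishedCocycle

/-! ### §3 Packaged over a number field: one `t` for all cocycles -/

section DistinguishedNumberField

universe u

variable {K : Type u} [Field K] [NumberField K] {R : Type u} [Ring R] [TopologicalSpace R]

/-- **Transport of cocycle values to the distinguished local Frobenius — packaged.**  Let `Fr` be an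
arithmetic Frobenius at some `𝔓 ∣ v`.  Then there is `t ∈ Γ_K` such that for EVERY continuous
`1`-cocycle `Φ` of ANY `TopRep` `X` of `Γ_K` on which the local inertia `I_{K_v}` acts trivially
(through `res`) and on which `Φ ∘ res` vanishes (the class of `Φ` is unramified at `v`), and EVERY
arithmetic Frobenius `r` of `K_v`: `Φ(Fr) = t·Φ(res r) − (Fr·Φ(t) − Φ(t))`.  ONE `t` serves all cocycles
(both `Φ` and `Ψc` of `stub_stepsTwoFour*`), so the pair `(Φ(Fr), Ψc(Fr))` is the `t`-translate of
`(Φ(res r), Ψc(res r))` up to `(Fr − 1)`-ambiguities. [cite: SerreLocalFields1979, Ch. I §8 and VII §5]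
[cite: NeukirchANT1999, Ch. II §9 Prop. (9.6)] -/
theorem exists_forall_apply_eq_smul_apply_absGaloisRestrict_sub {v : HeightOneSpectrum (𝓞 K)}
    {𝔓 : Ideal (absIntegers (𝓞 K) K)} (h𝔓 : 𝔓 ∈ v.primesAbove) {Fr : absoluteGaloisGroup K}
    (hFr : IsArithFrobAt (𝓞 K) Fr 𝔓) :
    ∃ t : absoluteGaloisGroup K, ∀ (X : TopRep.{u} R (absoluteGaloisGroup K)) (Φ : contOneCocycles X),
      (∀ i ∈ absInertia (v.adicCompletion K), ∀ x : X,
        X.ρ (absGaloisRestrict K (v.adicCompletion K) i) x = x) →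
      (∀ i ∈ absInertia (v.adicCompletion K), Φ.1 (absGaloisRestrict K (v.adicCompletion K) i) = 0) →
      ∀ r : absoluteGaloisGroup (v.adicCompletion K), IsAbsArithFrob r →
        Φ.1 Fr = X.ρ t (Φ.1 (absGaloisRestrict K (v.adicCompletion K) r)) - (X.ρ Fr (Φ.1 t) - Φ.1 t) := by
  obtain ⟨t, -, ht⟩ := exists_forall_isAbsArithFrob_mul_inv_conj_mem_map_absInertia h𝔓 hFr
  refine ⟨t⁻¹, fun X Φ hIX hI0 r hr => ?_⟩
  refine apply_eq_smul_apply_sub_of_mul_inv_conj_mem Φ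
    (I := (absInertia (v.adicCompletion K)).map (absGaloisRestrict K (v.adicCompletion K)).toMonoidHom)
    ?_ ?_ (ht r hr)
  · rintro j ⟨i, hi, rfl⟩ x
    exact hIX i hi x
  · rintro j ⟨i, hi, rfl⟩
    exact hI0 i hi

end DistinguishedNumberField

end Summit.BirchSwinnertonDyer.BirchSwinnertonDyer.Rank1Residual.StepsTwoFourTransport

end

/-! ## Append no. 1: the LOCAL Frobenius inherits `E`-splitness and depth from ANY Frobenius `Fr` of
ANY prime `𝔓 ∣ v` — the binders `hsplit`/`hφm`/`hφm'` of koly's local theory for every local Frobenius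
`r` of `K_v`, from the binders of `stub_stepsTwoFourOdd` on its global `Fr` -/

noncomputable section

open scoped NumberField
open Field WeierstrassCurve Literature.NumberTheory.EllipticCurves
  Literature.NumberTheory.GaloisRepresentations Function IsDedekindDomain NumberField
open Literature.NumberTheory.GaloisRepresentations.IsNonarchimedeanLocalField
open Literature.NumberTheory.Automorphic

namespace Summit.BirchSwinnertonDyer.BirchSwinnertonDyer.Rank1Residual.StepsTwoFourTransport

section LocalOfGlobal

universe u

variable {K : Type u} [Field K] [NumberField K] {M : Type u} [AddCommGroup M] [TopologicalSpace M]
  [DiscreteTopology M] (ρ : DiscreteGaloisModule K M) {p : ℕ} [Fact p.Prime] (κ : ZpExtension K p)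

/-- **Every local Frobenius of `K_v` is `ρ`-split of the same depth as a given split Frobenius `Fr` at
any `𝔓 ∣ v`.**  Let `ρ` be unramified at `v`, `v ∤ p`, `𝔓 ∣ v`, `Fr` an arithmetic Frobenius at `𝔓`
with `ρ(Fr) = 1`.  Then for EVERY arithmetic Frobenius `r` of the local field `K_v`:
`ρ(res r) = 1` and, for every `n`, `res r ∈ κ.layerSubgroup n ↔ Fr ∈ κ.layerSubgroup n` — because
`res r = j·(t·Fr·t⁻¹)` with `j` in the distinguished inertia (`exists_forall_isAbsArithFrob_mul_inv_conj_mem_map_absInertia`),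
on which `ρ` (`hunr`) and `κ` (`ZpExtension.inertia_le_kerSubgroup_holds`, `v ∤ p`) are trivial, and
`κ` is abelian.  With the binders of `stub_stepsTwoFourOdd` (`galoisRepTorsion W p Fr = 1`,
`Fr ∈ Γ_n ∖ Γ_{n+1}`) this gives koly's `hsplit`, `hφm`, `hφm'` for every local Frobenius.
[cite: NeukirchANT1999, Ch. II §9 Prop. (9.6)] [cite: Washington1997, Prop. 13.2] -/
theorem apply_absGaloisRestrict_eq_one_and_mem_layerSubgroup_iff_of_isArithFrobAt
    {v : HeightOneSpectrum (𝓞 K)} (hunr : GaloisRep.IsUnramifiedAt v ρ) (hvp : (p : 𝓞 K) ∉ v.asIdeal)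
    {𝔓 : Ideal (absIntegers (𝓞 K) K)} (h𝔓 : 𝔓 ∈ v.primesAbove) {Fr : absoluteGaloisGroup K}
    (hFr : IsArithFrobAt (𝓞 K) Fr 𝔓) (hρ : ρ Fr = 1) {r : absoluteGaloisGroup (v.adicCompletion K)}
    (hr : IsAbsArithFrob r) :
    ρ (absGaloisRestrict K (v.adicCompletion K) r) = 1 ∧
      ∀ n : ℕ, absGaloisRestrict K (v.adicCompletion K) r ∈ κ.layerSubgroup n ↔ Fr ∈ κ.layerSubgroup n := by
  classical
  obtain ⟨t, -, ht⟩ := exists_forall_isAbsArithFrob_mul_inv_conj_mem_map_absInertia h𝔓 hFr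
  set ρr := absGaloisRestrict K (v.adicCompletion K) r with hρr
  -- the inertia factor `j = ρr · (t Fr t⁻¹)⁻¹` lies in `I_{𝔓₀}`
  have hjI : ρr * (t * Fr * t⁻¹)⁻¹ ∈ (adicCompletionPrime K v).inertia (absoluteGaloisGroup K) := by
    rw [inertia_adicCompletionPrime_eq_map_absInertia]
    exact ht r hr
  have hρj : ρ (ρr * (t * Fr * t⁻¹)⁻¹) = 1 := hunr _ (adicCompletionPrime_mem_primesAbove K v) _ hjI
  have hκj : κ (ρr * (t * Fr * t⁻¹)⁻¹) = 1 :=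
    ZpExtension.mem_kerSubgroup.1
      (ZpExtension.inertia_le_kerSubgroup_holds K p κ hvp (adicCompletionPrime_mem_primesAbove K v) hjI)
  have hdec : ρr = ρr * (t * Fr * t⁻¹)⁻¹ * (t * Fr * t⁻¹) := by group
  refine ⟨?_, fun n => ?_⟩
  · rw [hdec, map_mul, hρj, one_mul, map_mul, map_mul, hρ, mul_one, ← map_mul, mul_inv_cancel, map_one]
  · have hκ : κ ρr = κ Fr := by
      rw [hdec, map_mul, hκj, one_mul, map_mul, map_mul, map_inv, mul_comm (κ t), mul_assoc,
        mul_inv_cancel, mul_one]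
    rw [ZpExtension.mem_layerSubgroup, ZpExtension.mem_layerSubgroup, hκ]

/-- Corollary in the shape of koly's binders: `hsplit`, `hφm`, `hφm'` for every local Frobenius `r`
from `ρ(Fr) = 1`, `Fr ∈ Γ_m ∖ Γ_{m+1}` at any `𝔓 ∣ v`. [cite: NeukirchANT1999, Ch. II §9 Prop. (9.6)]
[cite: Washington1997, Prop. 13.2] -/
theorem isSplit_and_depth_absGaloisRestrict_of_isArithFrobAt {v : HeightOneSpectrum (𝓞 K)}
    (hunr : GaloisRep.IsUnramifiedAt v ρ) (hvp : (p : 𝓞 K) ∉ v.asIdeal)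
    {𝔓 : Ideal (absIntegers (𝓞 K) K)} (h𝔓 : 𝔓 ∈ v.primesAbove) {Fr : absoluteGaloisGroup K}
    (hFr : IsArithFrobAt (𝓞 K) Fr 𝔓) (hρ : ρ Fr = 1) {m : ℕ} (hFrm : Fr ∈ κ.layerSubgroup m)
    (hFrm' : Fr ∉ κ.layerSubgroup (m + 1)) {r : absoluteGaloisGroup (v.adicCompletion K)}
    (hr : IsAbsArithFrob r) :
    ρ (absGaloisRestrict K (v.adicCompletion K) r) = 1 ∧
      absGaloisRestrict K (v.adicCompletion K) r ∈ κ.layerSubgroup m ∧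
      absGaloisRestrict K (v.adicCompletion K) r ∉ κ.layerSubgroup (m + 1) := by
  obtain ⟨h1, hiff⟩ :=
    apply_absGaloisRestrict_eq_one_and_mem_layerSubgroup_iff_of_isArithFrobAt ρ κ hunr hvp h𝔓 hFr hρ hr
  exact ⟨h1, (hiff m).2 hFrm, fun h => hFrm' ((hiff (m + 1)).1 h)⟩

end LocalOfGlobal

section LocalOfGlobalRat

variable (W : WeierstrassCurve ℚ) (p : ℕ) [Fact p.Prime] (κ : ZpExtension ℚ p)

/-- **For an elliptic curve over `ℚ`, in the stub's spelling**: from `galoisRepTorsion W p Fr = 1`,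
`Fr ∈ Γ_m ∖ Γ_{m+1}` at a Frobenius `Fr` of any `𝔓 ∣ q` (`q ∤ p`, `E[p]` unramified at `q`), every
local Frobenius `r` of `ℚ_q` satisfies `W.torsionGaloisModule p (res r) = 1` (koly's `hsplit`),
`galoisRepTorsion W p (res r) = 1`, `res r ∈ Γ_m`, `res r ∉ Γ_{m+1}`.
[cite: NeukirchANT1999, Ch. II §9 Prop. (9.6)] [cite: Washington1997, Prop. 13.2] -/
theorem isSplit_and_depth_absGaloisRestrict_of_isArithFrobAt_rat {q : HeightOneSpectrum (𝓞 ℚ)}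
    (hur : GaloisRep.IsUnramifiedAt q (W.torsionGaloisModule (p : ℤ)))
    (hqp : ((p : ℕ) : 𝓞 ℚ) ∉ q.asIdeal) {𝔓 : Ideal (absIntegers (𝓞 ℚ) ℚ)} (h𝔓 : 𝔓 ∈ q.primesAbove)
    {Fr : absoluteGaloisGroup ℚ} (hFr : IsArithFrobAt (𝓞 ℚ) Fr 𝔓) (hρ : galoisRepTorsion W p Fr = 1)
    {m : ℕ} (hFrm : Fr ∈ κ.layerSubgroup m) (hFrm' : Fr ∉ κ.layerSubgroup (m + 1))
    {r : absoluteGaloisGroup (q.adicCompletion ℚ)} (hr : IsAbsArithFrob r) :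
    W.torsionGaloisModule (p : ℤ) (absGaloisRestrict ℚ (q.adicCompletion ℚ) r) = 1 ∧
      galoisRepTorsion W p (absGaloisRestrict ℚ (q.adicCompletion ℚ) r) = 1 ∧
      absGaloisRestrict ℚ (q.adicCompletion ℚ) r ∈ κ.layerSubgroup m ∧
      absGaloisRestrict ℚ (q.adicCompletion ℚ) r ∉ κ.layerSubgroup (m + 1) := by
  have hρ' : W.torsionGaloisModule (p : ℤ) Fr = 1 :=
    LinearMap.ext fun Q => by
      rw [torsionGaloisModule_apply_apply]
      exact forall_smul_eq_of_galoisRepTorsion_eq_one W p hρ Q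
  obtain ⟨h1, hm, hm'⟩ := isSplit_and_depth_absGaloisRestrict_of_isArithFrobAt
    (W.torsionGaloisModule (p : ℤ)) κ hur hqp h𝔓 hFr hρ' hFrm hFrm' hr
  refine ⟨h1, galoisRepTorsion_eq_one_of_forall_smul_eq W p fun Q => ?_, hm, hm'⟩
  rw [← torsionGaloisModule_apply_apply, h1]
  rfl

end LocalOfGlobalRat

end Summit.BirchSwinnertonDyer.BirchSwinnertonDyer.Rank1Residual.StepsTwoFourTransport

end
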